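import Literature.MathematicalPhysics.QuantumLattice.HubbardHubbardModelEtaODLROProofs

/-!
# Crux `TwSeededEnsembleEquivalence` (stmt-HubbardSuperconductivity-1698), line `exposed-density-duality` —
# structural barrier, stub B1c `stub_siteBookkeeping`: site bookkeeping on the Hubbard torus

Pure finite combinatorics of occupation configurations `s : Finset (Orb Λ)` of the Hubbard
orbital set `Orb Λ = Λ ×ₗ Fin 2` (`orb x σ = toLex (x, σ)`) over the torus
`Λ = FermionTorus 2 L` (`|Λ| = L²`). Every site `x` is empty, singly or doubly occupied in `s`;
writing `S, D, E` for the numbers of singly occupied, doubly occupied and empty sites,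
`#s = S + 2D` and `L² = S + D + E`, hence the bookkeeping identity

  `#s + E(s) = L² + D(s)`,  `D(s) = #{x | x↑ ∈ s ∧ x↓ ∈ s}`, `E(s) = #{x | x↑ ∉ s ∧ x↓ ∉ s}`.

The proof writes all four quantities as sums over the sites of `{0,1,2}`-valued indicator
expressions (`#s = Σ_x ([x↑ ∈ s] + [x↓ ∈ s])`, Tasaki (2020) §9.2) and checks the pointwise
identity `([a] + [b]) + [¬a ∧ ¬b] = 1 + [a ∧ b]`. Everything is `ℕ`-valued; no definitions are
introduced. [folklore]
-/

-- the tree's layout `Summit.HubbardSuperconductivity.HubbardSuperconductivity.…` repeats a namespace component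
set_option linter.dupNamespace false

noncomputable section

namespace Summit.HubbardSuperconductivity.HubbardSuperconductivity.Theorems.TwSeededEnsembleEquivalence.ExposedDensity

open Finset Literature.MathematicalPhysics.QuantumLattice

/-- `#s = Σ_x ([x↑ ∈ s] + [x↓ ∈ s])` (ℕ-valued) for a configuration of Hubbard orbitals on the
torus: the particle number is the sum of the site occupations. Tasaki (2020) §9.2. [folklore] -/
theorem siteBookkeeping_card_eq_sum (L : ℕ) (s : Finset (Orb (FermionTorus 2 L))) :
    s.card = ∑ x : FermionTorus 2 L,
      ((if orb x 0 ∈ s then 1 else 0) + (if orb x 1 ∈ s then 1 else 0)) := by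
  have h1 : s.card = ∑ o : Orb (FermionTorus 2 L), (if o ∈ s then 1 else 0) := by
    rw [Finset.sum_boole, Nat.cast_id, Finset.filter_mem_eq_inter, Finset.univ_inter]
  rw [h1, ← (toLex : FermionTorus 2 L × Fin 2 ≃ Orb (FermionTorus 2 L)).sum_comp,
    Fintype.sum_prod_type]
  simp only [Fin.sum_univ_two]

/-- **Site bookkeeping** (structural barrier, stub B1c). For every configuration `s` of Hubbard
orbitals on the `L × L` torus, `#s + E(s) = L² + D(s)`, where `D(s)` is the number of doubly
occupied sites (`x↑ ∈ s` and `x↓ ∈ s`) and `E(s)` the number of empty sites (`x↑ ∉ s` and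
`x↓ ∉ s`): each site is empty, singly or doubly occupied, so `#s = S + 2D` and `L² = S + D + E`.
[folklore] -/
theorem stub_siteBookkeeping :
    ∀ (L : ℕ) [NeZero L] (s : Finset (Orb (FermionTorus 2 L))),
      s.card + ((Finset.univ.filter fun x : FermionTorus 2 L => orb x 0 ∉ s).filter fun x => orb x 1 ∉ s).card =
        L ^ 2 + ((Finset.univ.filter fun x : FermionTorus 2 L => orb x 0 ∈ s).filter fun x => orb x 1 ∈ s).card := by
  intro L _ s
  have hL : L ^ 2 = ∑ _x : FermionTorus 2 L, (1 : ℕ) := by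
    rw [Finset.sum_const, smul_eq_mul, mul_one, Finset.card_univ, card_fermionTorus]
  rw [siteBookkeeping_card_eq_sum L s, Finset.card_filter, Finset.sum_filter, Finset.card_filter,
    Finset.sum_filter, hL, ← Finset.sum_add_distrib, ← Finset.sum_add_distrib]
  refine Finset.sum_congr rfl fun x _ => ?_
  by_cases h0 : orb x 0 ∈ s <;> by_cases h1 : orb x 1 ∈ s <;> simp [h0, h1]

end Summit.HubbardSuperconductivity.HubbardSuperconductivity.Theorems.TwSeededEnsembleEquivalence.ExposedDensity

end
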